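import Mathlib
import Summits.MatrixMultiplication.MatrixMultiplication.Theses.ThinBlockAlpha

/-!
# Line `gibbs-partition-charts` — crux `ThinBlockAlpha.BoundedExponentThird` (stmt-MatrixMultiplication-10596)

Skeleton line (crux-plan seat `planner-cruxplan-stmt-MatrixMultiplication-10596-gibbs-partition-char-0`,
2026-08-16) for the crux idea `Cruxes/BoundedExponentThird/Ideas/gibbs-partition-charts.md`.

THE LINE.  A Cohn–Kleinberg–Szegedy–Umans *chart design* (arXiv:math/0511460, Def. 36 / Thm. 37):
symbols `x : Fin r` carry TPP triples `(A x, B x, C x)` of subsets of `H₀ = ZMod 7`; a code of rows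
`row i : Fin (14k) → Fin r` whose every ordered triple of rows (indices not all equal) has a SAFE
coordinate (tree threading of `IsSTPP`: `0 ∉ (A x − A z) + (B y − B x) + (C z − C y)`) gives an STPP
family of product blocks in `Fin (14k) → ZMod 7` (exponent 7) — `stub_chartSTPP` = CKSU Thm 37.
Two-leg tightness `|H| ≤ L·N^{2+η}` for every `η` forces the long-leg cells `C x − A x` to PARTITION
`H₀` and the row composition to be the Gibbs law of the partition (the idea card's criterion); for
the completed Coppersmith–Winograd chart (symbols of four TYPES: `A`-fat `(5,1,1)`, `C`-fat
`(1,1,5)`, and `B`-active pins `(1,b₂,1)`, `(1,b₃,1)` on the two remaining cells, `b₂ b₃ ≥ 4`; any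
number of symbols per type — offset variants / twin symbols are free) the Gibbs TYPE class is
`(5k, 5k, 2k, 2k)` on width `14k`, the cell-word count is `C(14k,4k)·C(4k,2k)` and the packing
identity is `stub_cellCount`: `7^{14k} ≤ (14k+1)²·C(14k,4k)C(4k,2k)·5^{10k}`.  The blocks are
`⟨5^{5k}, (b₂b₃)^{2k}, 5^{5k}⟩`, so `M³ ≥ 4096^k ≥ 3125^k = N` (`a = 2 log₂(b₂b₃)/(5 log₂ 5) ≥ 0.344`).
What is left is the LOAD-BEARING stub `stub_capacity` (= the card's transfer `C⁺ = ChartDesign7`,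
alphabet and offsets freed): some chart of that shape admits safe codes of size `C(14k,4k)C(4k,2k)·2^{−δk}` for
every `δ > 0` and infinitely many `k` — a capacity EQUALITY for the chart's safe 3-uniform
hypergraph at the Gibbs point (rows of a safe code have pairwise distinct cell words, so
`L ≤ C(14k,4k)C(4k,2k)` always).  `BoundedExponentThird_of` assembles the crux from the three stubs
(kernel-checked, no sorry outside `stub_*`).

Disproof.lean honoured (cdisprove cycle 1; landed `Theorems/BoundedExponentThird/Negative/*`): the
designs have `N = 5^{5k} → ∞` (`not_BoundedExponentThirdBoundedN`), `L = 2^{Θ(k)} ≫ M`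
(`two_leg_bound`), middle sets `B_u = ∏ B (row u c)` supported on the row's pin positions (no
common translate sub-pattern across a spread code: `not_BoundedExponentThirdTranslateB`), leg sets
`∏ (C − A)(row u c)` with cells `{·}`, `{·}`, 5-sets that are not cosets of one subgroup
(`not_BoundedExponentThirdCosetLegs`), outer sets not translates of one set
(`not_BoundedExponentThirdTranslateA`).  No `_false_without_` theorem is registered yet.
-/

open scoped Pointwise BigOperators
open Finset Literature.Computability.AlgebraicComplexity
open Summit.MatrixMultiplication.MatrixMultiplication.Theses.ThinBlockAlpha (BoundedExponentThird)

namespace Summit.MatrixMultiplication.MatrixMultiplication.Cruxes.BoundedExponentThird.GibbsPartitionCharts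

/-! ## The three stubs -/

/-- **stub_chartSTPP — CKSU 2005 Thm 37 in the tree's threading of `IsSTPP`** (shared first lemma of
all chart lines; `SketchIdeator1.isSTPP_of_localChartUSP` is the same statement): over a chart of
TPP symbols `(A x, B x, C x)`, `x : Γ`, a family of rows in which every ordered triple with indices
not all equal has a coordinate `c` whose pattern `(row i c, row j c, row k c)` is SAFE —
`0 ∉ (A x − A z) + (B y − B x) + (C z − C y)` — yields an `IsSTPP` family of product blocks in
`Fin n → H₀`.  Size M (the proof of `CohnKleinbergSzegedyUmans2005_thm33_holds` with "exactly one
nonzero term" replaced by the safe-pattern hypothesis, plus the diagonal case from symbol TPP).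
[arXiv:math/0511460, Def. 36, Thm. 37] -/
theorem stub_chartSTPP {H₀ Γ : Type} [AddCommGroup H₀] [DecidableEq H₀]
    (A B C : Γ → Finset H₀)
    (hTPP : ∀ x : Γ, ∀ a ∈ A x, ∀ a' ∈ A x, ∀ b ∈ B x, ∀ b' ∈ B x, ∀ c ∈ C x, ∀ c' ∈ C x,
      (a' - a) + (b' - b) + (c' - c) = 0 → a = a' ∧ b = b' ∧ c = c')
    {n L : ℕ} (row : Fin L → Fin n → Γ)
    (husp : ∀ i j k : Fin L, ¬ (i = j ∧ j = k) → ∃ c : Fin n,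
      (0 : H₀) ∉ (A (row i c) - A (row k c)) + (B (row j c) - B (row i c)) +
        (C (row k c) - C (row j c))) :
    IsSTPP (fun i => Fintype.piFinset fun c => A (row i c))
      (fun i => Fintype.piFinset fun c => B (row i c))
      (fun i => Fintype.piFinset fun c => C (row i c)) := by
  sorry

/-- **stub_cellCount — the Gibbs / zero-loss packing count of the completed Coppersmith–Winograd
cell structure over `ZMod 7`** (cells of sizes `5, 1, 1`; Gibbs composition `(10k, 2k, 2k)` of
width `14k`; `C(14k,4k)·C(4k,2k)` cell words): `7^{14k} = Σ_j C(14k,j) 2^j 5^{14k-j}` has its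
mode at `j = 4k` and `2^{4k} = Σ_i C(4k,i) ≤ (4k+1)·C(4k,2k)`, whence
`7^{14k} ≤ (14k+1)²·C(14k,4k)·C(4k,2k)·5^{10k}`.  Size S/M (two ratio tests, cf. the tree's
`seven_pow_le_succ_mul_choose_mul_pow`). [folklore; method of types] -/
theorem stub_cellCount (k : ℕ) :
    7 ^ (14 * k) ≤
      (14 * k + 1) ^ 2 * (Nat.choose (14 * k) (4 * k) * Nat.choose (4 * k) (2 * k)) * 5 ^ (10 * k) := by
  sorry

/-- **stub_capacity — THE LOAD-BEARING STUB (the idea's transfer `C⁺ = ChartDesign7`, alphabet and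
offsets freed): a completed Coppersmith–Winograd chart over `ZMod 7` whose safe hypergraph has codes
of full Gibbs rate.**  There is a finite alphabet `Fin r` of symbols `x`, each of one of four CW TYPES
`ty x` — type `0`: `A`-fat `(|A x|, |B x|, |C x|) = (5,1,1)`; type `1`: `C`-fat `(1,1,5)`; types
`2, 3`: `B`-active pins `(1, b₂, 1)`, `(1, b₃, 1)` with `b₂·b₃ ≥ 4` (several symbols may share a
type: offset variants, twin symbols) — such that for every `δ > 0` and infinitely many `k` some
family of `L` rows of width `14k`, all of TYPE composition `(5k, 5k, 2k, 2k)`, is SAFE (every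
ordered triple of rows with indices not all equal has a coordinate whose pattern value set
`(A x − A z) + (B y − B x) + (C z − C y)` misses `0` — the tree threading of `IsSTPP`) and has
`C(14k,4k)·C(4k,2k) ≤ 2^{δk}·L`.  Two-leg tightness forces the long-leg cells `C x − A x` of the
symbols USED to form the partition `Z_7 = F ⊔ {p} ⊔ {q}` (types `0,1 ↦ F`, `2 ↦ {p}`, `3 ↦ {q}`)
and rows of a safe family to have pairwise distinct CELL words, so `L ≤ C(14k,4k)C(4k,2k)` always:
the stub is a capacity EQUALITY for a 3-uniform hypergraph restricted to the Gibbs class.  Why it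
might fail: the only capacity theorem in print (CW/BCS hashing, tree `BCS1997_thm1539_free`) needs
a linear trapping of the unsafe patterns, and the triage scans (TRIAGE-r1-1/2) find every
two-B-active-pin chart over `Z_7` untrapped (all-unsafe Latin orbits, poisoned pattern `(C, A, ⋆)`);
the best 4-symbol chart found (card: `A = ({2..6},{0},{0})`, `C = ({0},{0},{1..5})`,
`B = ({0},{3,4},{0})`, `⋆ = ({0},{1,5},{6})`, 20 safe patterns of 64) passes only the pair/3-wise
colouring NECESSARY bounds.  Size XL.
[arXiv:math/0511460 Thm 13, §6.3, Def. 36, Thm. 37; Coppersmith–Winograd 1990 §6; arXiv:1605.06702 Thm B] -/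
theorem stub_capacity :
    ∃ (r : ℕ) (ty : Fin r → Fin 4) (A B C : Fin r → Finset (ZMod 7)) (b₂ b₃ : ℕ),
      4 ≤ b₂ * b₃ ∧
      (∀ x : Fin r,
        (ty x = 0 → (A x).card = 5 ∧ (B x).card = 1 ∧ (C x).card = 1) ∧
        (ty x = 1 → (A x).card = 1 ∧ (B x).card = 1 ∧ (C x).card = 5) ∧
        (ty x = 2 → (A x).card = 1 ∧ (B x).card = b₂ ∧ (C x).card = 1) ∧
        (ty x = 3 → (A x).card = 1 ∧ (B x).card = b₃ ∧ (C x).card = 1)) ∧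
      ∀ δ : ℝ, 0 < δ → ∀ k₀ : ℕ, ∃ k : ℕ, k₀ ≤ k ∧
        ∃ (L : ℕ) (row : Fin L → Fin (14 * k) → Fin r),
          (∀ i j l : Fin L, ¬ (i = j ∧ j = l) → ∃ c : Fin (14 * k),
            (0 : ZMod 7) ∉ (A (row i c) - A (row l c)) + (B (row j c) - B (row i c)) +
              (C (row l c) - C (row j c))) ∧
          (∀ i : Fin L, (univ.filter fun c => ty (row i c) = 0).card = 5 * k ∧
            (univ.filter fun c => ty (row i c) = 1).card = 5 * k ∧
            (univ.filter fun c => ty (row i c) = 2).card = 2 * k ∧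
            (univ.filter fun c => ty (row i c) = 3).card = 2 * k) ∧
          ((Nat.choose (14 * k) (4 * k) * Nat.choose (4 * k) (2 * k) : ℕ) : ℝ) ≤
            (2 : ℝ) ^ (δ * k) * L := by
  sorry

/-! ## Proved glue (no sorry below this line) -/

/-- A chart symbol two of whose three sets are singletons is automatically TPP. -/
theorem symbolTPP_of_card_eq_one {H₀ : Type} [AddCommGroup H₀] (A B C : Finset H₀)
    (h : (B.card = 1 ∧ C.card = 1) ∨ (A.card = 1 ∧ B.card = 1) ∨ (A.card = 1 ∧ C.card = 1)) :
    ∀ a ∈ A, ∀ a' ∈ A, ∀ b ∈ B, ∀ b' ∈ B, ∀ c ∈ C, ∀ c' ∈ C,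
      (a' - a) + (b' - b) + (c' - c) = 0 → a = a' ∧ b = b' ∧ c = c' := by
  intro a ha a' ha' b hb b' hb' c hc c' hc' he
  rcases h with ⟨h1, h2⟩ | ⟨h1, h2⟩ | ⟨h1, h2⟩
  · obtain ⟨p, hp⟩ := Finset.card_eq_one.1 h1
    obtain ⟨q, hq⟩ := Finset.card_eq_one.1 h2
    rw [hp, Finset.mem_singleton] at hb hb'
    rw [hq, Finset.mem_singleton] at hc hc'
    subst hb; subst hb'; subst hc; subst hc'
    have : a' - a = 0 := by simpa using he
    exact ⟨(sub_eq_zero.1 this).symm, rfl, rfl⟩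
  · obtain ⟨p, hp⟩ := Finset.card_eq_one.1 h1
    obtain ⟨q, hq⟩ := Finset.card_eq_one.1 h2
    rw [hp, Finset.mem_singleton] at ha ha'
    rw [hq, Finset.mem_singleton] at hb hb'
    subst ha; subst ha'; subst hb; subst hb'
    have : c' - c = 0 := by simpa using he
    exact ⟨rfl, rfl, (sub_eq_zero.1 this).symm⟩
  · obtain ⟨p, hp⟩ := Finset.card_eq_one.1 h1
    obtain ⟨q, hq⟩ := Finset.card_eq_one.1 h2
    rw [hp, Finset.mem_singleton] at ha ha'
    rw [hq, Finset.mem_singleton] at hc hc'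
    subst ha; subst ha'; subst hc; subst hc'
    have : b' - b = 0 := by simpa using he
    exact ⟨rfl, (sub_eq_zero.1 this).symm, rfl⟩

/-- Regrouping a product over coordinates by the value of a labelling:
`∏_c g (w c) = ∏_x (g x) ^ #{c | w c = x}` (used with `w = ty ∘ row i` to read block sizes off the
type composition of a row). -/
theorem prod_comp_eq_prod_pow_card {Γ : Type} [Fintype Γ] [DecidableEq Γ] {n : ℕ}
    (g : Γ → ℕ) (w : Fin n → Γ) :
    ∏ c, g (w c) = ∏ x : Γ, g x ^ (univ.filter fun c => w c = x).card := by
  rw [← Finset.prod_fiberwise_of_maps_to (s := univ) (t := univ) (g := w) (fun _ _ => mem_univ _)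
      (fun c => g (w c))]
  refine Finset.prod_congr rfl fun x _ => ?_
  rw [Finset.prod_congr rfl (fun c hc => by rw [(Finset.mem_filter.1 hc).2]), Finset.prod_const]

/-- Polynomial versus exponential growth: `(14k+1)² ≤ r^k` eventually, for `r > 1`. -/
theorem exists_sq_affine_le_pow {r : ℝ} (hr : 1 < r) :
    ∃ k₀ : ℕ, ∀ k : ℕ, k₀ ≤ k → ((14 * k + 1 : ℝ)) ^ 2 ≤ r ^ k := by
  have h := tendsto_pow_const_div_const_pow_of_one_lt 2 hr
  have h' : ∀ᶠ n : ℕ in Filter.atTop, (n : ℝ) ^ 2 / r ^ n < 1 / 225 :=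
    h.eventually (gt_mem_nhds (by norm_num))
  obtain ⟨N, hN⟩ := Filter.eventually_atTop.1 h'
  refine ⟨max N 1, fun k hk => ?_⟩
  have hkN : N ≤ k := le_trans (le_max_left _ _) hk
  have hk1 : (1 : ℝ) ≤ k := by exact_mod_cast le_trans (le_max_right _ _) hk
  have hrk : 0 < r ^ k := pow_pos (by linarith) k
  have h1 := hN k hkN
  rw [div_lt_iff₀ hrk] at h1
  have h2 : ((14 * k + 1 : ℝ)) ^ 2 ≤ 225 * (k : ℝ) ^ 2 := by nlinarith
  linarith

/-- **The skeleton: `stub_chartSTPP`, `stub_cellCount`, `stub_capacity` ⟹ the crux.**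
Take `ℓ = 7`.  Given `η > 0`, run `stub_capacity` with `δ := η` beyond the growth threshold of
`(14k+1)² ≤ ((3125/2)^η)^k`; the safe family is an STPP family in `Fin (14k) → ZMod 7`
(`stub_chartSTPP`, symbol TPP being automatic for CW-typed symbols), with uniform blocks
`⟨5^{5k}, b₂^{2k} b₃^{2k}, 5^{5k}⟩` (`prod_comp_eq_prod_pow_card` on the type word of a row),
`M³ ≥ 4096^k ≥ 5^{5k} = N`, and `|H| = 7^{14k} ≤ (14k+1)²·C(14k,4k)C(4k,2k)·5^{10k}
≤ ((3125/2)^η)^k·2^{ηk}·L·5^{10k} = L·N^{2+η}` (`stub_cellCount`). -/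
theorem BoundedExponentThird_of : BoundedExponentThird := by
  obtain ⟨r, ty, A, B, C, b₂, b₃, hBB, hshape, hcap⟩ := stub_capacity
  refine ⟨7, fun η hη => ?_⟩
  -- growth threshold
  have hr : (1 : ℝ) < (3125 / 2 : ℝ) ^ η := Real.one_lt_rpow (by norm_num) hη
  obtain ⟨k₁, hk₁⟩ := exists_sq_affine_le_pow hr
  obtain ⟨k, hk, L, row, husp, hcomp, hrate⟩ := hcap η hη (max k₁ 1)
  have hkk₁ : k₁ ≤ k := le_trans (le_max_left _ _) hk
  have hk1 : 1 ≤ k := le_trans (le_max_right _ _) hk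
  -- every symbol has one of the four types
  have hty : ∀ x : Fin r, ty x = 0 ∨ ty x = 1 ∨ ty x = 2 ∨ ty x = 3 := by
    intro x
    generalize ty x = t
    fin_cases t <;> simp
  -- symbol TPP is automatic for CW-typed symbols (two singleton parts)
  have hTPP : ∀ x : Fin r, ∀ a ∈ A x, ∀ a' ∈ A x, ∀ b ∈ B x, ∀ b' ∈ B x, ∀ c ∈ C x, ∀ c' ∈ C x,
      (a' - a) + (b' - b) + (c' - c) = 0 → a = a' ∧ b = b' ∧ c = c' := by
    intro x
    obtain ⟨h0, h1, h2, h3⟩ := hshape x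
    rcases hty x with h | h | h | h
    · exact symbolTPP_of_card_eq_one _ _ _ (Or.inl ⟨(h0 h).2.1, (h0 h).2.2⟩)
    · exact symbolTPP_of_card_eq_one _ _ _ (Or.inr (Or.inl ⟨(h1 h).1, (h1 h).2.1⟩))
    · exact symbolTPP_of_card_eq_one _ _ _ (Or.inr (Or.inr ⟨(h2 h).1, (h2 h).2.2⟩))
    · exact symbolTPP_of_card_eq_one _ _ _ (Or.inr (Or.inr ⟨(h3 h).1, (h3 h).2.2⟩))
  have hSTPP := stub_chartSTPP A B C hTPP row husp
  -- sizes of the three sets of a symbol as functions of its type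
  have hAcard : ∀ x, (A x).card = (if ty x = 0 then 5 else 1) := by
    intro x
    obtain ⟨h0, h1, h2, h3⟩ := hshape x
    rcases hty x with h | h | h | h
    · simp [h, (h0 h).1]
    · simp [h, (h1 h).1]
    · simp [h, (h2 h).1]
    · simp [h, (h3 h).1]
  have hCcard : ∀ x, (C x).card = (if ty x = 1 then 5 else 1) := by
    intro x
    obtain ⟨h0, h1, h2, h3⟩ := hshape x
    rcases hty x with h | h | h | h
    · simp [h, (h0 h).2.2]
    · simp [h, (h1 h).2.2]
    · simp [h, (h2 h).2.2]
    · simp [h, (h3 h).2.2]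
  have hBcard : ∀ x, (B x).card = (if ty x = 2 then b₂ else if ty x = 3 then b₃ else 1) := by
    intro x
    obtain ⟨h0, h1, h2, h3⟩ := hshape x
    rcases hty x with h | h | h | h
    · simp [h, (h0 h).2.1]
    · simp [h, (h1 h).2.1]
    · simp [h, (h2 h).2.1]
    · simp [h, (h3 h).2.1]
  -- the blocks and their sizes, read off the type composition of a row
  have hcardA : ∀ i, (Fintype.piFinset fun c => A (row i c)).card = 5 ^ (5 * k) := by
    intro i
    obtain ⟨h0, h1, h2, h3⟩ := hcomp i
    rw [Fintype.card_piFinset, Finset.prod_congr rfl (fun c _ => hAcard (row i c)),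
      prod_comp_eq_prod_pow_card (fun t : Fin 4 => if t = 0 then 5 else 1) (fun c => ty (row i c)),
      Fin.prod_univ_four, h0, h1, h2, h3]
    simp
  have hcardC : ∀ i, (Fintype.piFinset fun c => C (row i c)).card = 5 ^ (5 * k) := by
    intro i
    obtain ⟨h0, h1, h2, h3⟩ := hcomp i
    rw [Fintype.card_piFinset, Finset.prod_congr rfl (fun c _ => hCcard (row i c)),
      prod_comp_eq_prod_pow_card (fun t : Fin 4 => if t = 1 then 5 else 1) (fun c => ty (row i c)),
      Fin.prod_univ_four, h0, h1, h2, h3]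
    simp
  have hcardB : ∀ i, (Fintype.piFinset fun c => B (row i c)).card = (b₂ * b₃) ^ (2 * k) := by
    intro i
    obtain ⟨h0, h1, h2, h3⟩ := hcomp i
    rw [Fintype.card_piFinset, Finset.prod_congr rfl (fun c _ => hBcard (row i c)),
      prod_comp_eq_prod_pow_card (fun t : Fin 4 => if t = 2 then b₂ else if t = 3 then b₃ else 1)
        (fun c => ty (row i c)),
      Fin.prod_univ_four, h0, h1, h2, h3]
    simp [mul_pow]
  refine ⟨(Fin (14 * k) → ZMod 7), inferInstance, inferInstance, L, 5 ^ (5 * k), (b₂ * b₃) ^ (2 * k),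
    (fun i => Fintype.piFinset fun c => A (row i c)),
    (fun i => Fintype.piFinset fun c => B (row i c)),
    (fun i => Fintype.piFinset fun c => C (row i c)), ?_, hSTPP, ?_, ?_, ?_, ?_⟩
  · -- the exponent of `Cyc₇^{14k}` divides `7`
    refine Nat.le_of_dvd (by norm_num) (AddMonoid.exponent_dvd_of_forall_nsmul_eq_zero ?_)
    intro x
    funext c
    show (7 : ℕ) • x c = 0
    rw [nsmul_eq_mul, ZMod.natCast_self, zero_mul]
  · -- uniform blocks `⟨5^{5k}, (b₂b₃)^{2k}, 5^{5k}⟩`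
    intro i
    exact ⟨hcardA i, hcardB i, hcardC i⟩
  · -- `2 ≤ 5^{5k}`
    calc (2 : ℕ) ≤ 5 ^ 1 := by norm_num
      _ ≤ 5 ^ (5 * k) := Nat.pow_le_pow_right (by norm_num) (by omega)
  · -- `(5^{5k})^{1/3} ≤ (b₂b₃)^{2k}` because `5^{5k} ≤ ((b₂b₃)^{2k})³`
    have hNM : (5 : ℕ) ^ (5 * k) ≤ ((b₂ * b₃) ^ (2 * k)) ^ 3 := by
      calc (5 : ℕ) ^ (5 * k) = 3125 ^ k := by rw [pow_mul]; norm_num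
        _ ≤ 4096 ^ k := Nat.pow_le_pow_left (by norm_num) k
        _ = (4 ^ (2 * k)) ^ 3 := by
            rw [← pow_mul, show 2 * k * 3 = 6 * k by ring, pow_mul]; norm_num
        _ ≤ ((b₂ * b₃) ^ (2 * k)) ^ 3 :=
            Nat.pow_le_pow_left (Nat.pow_le_pow_left hBB _) 3
    have h1 : ((5 ^ (5 * k) : ℕ) : ℝ) ≤ (((b₂ * b₃) ^ (2 * k) : ℕ) : ℝ) ^ (3 : ℕ) := by
      exact_mod_cast hNM
    have hM0 : (0 : ℝ) ≤ (((b₂ * b₃) ^ (2 * k) : ℕ) : ℝ) := Nat.cast_nonneg _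
    calc ((5 ^ (5 * k) : ℕ) : ℝ) ^ (1 / 3 : ℝ)
        ≤ ((((b₂ * b₃) ^ (2 * k) : ℕ) : ℝ) ^ (3 : ℕ)) ^ (1 / 3 : ℝ) :=
          Real.rpow_le_rpow (by positivity) h1 (by norm_num)
      _ = (((b₂ * b₃) ^ (2 * k) : ℕ) : ℝ) := by
          rw [← Real.rpow_natCast _ 3, ← Real.rpow_mul hM0]
          norm_num
  · -- the packing bound `7^{14k} ≤ L · (5^{5k})^{2+η}`
    have hcard : Fintype.card (Fin (14 * k) → ZMod 7) = 7 ^ (14 * k) := by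
      rw [Fintype.card_fun, ZMod.card, Fintype.card_fin]
    rw [hcard]
    push_cast
    have hA : (7 : ℝ) ^ (14 * k) ≤
        (14 * k + 1) ^ 2 * (Nat.choose (14 * k) (4 * k) * Nat.choose (4 * k) (2 * k)) * 5 ^ (10 * k) := by
      exact_mod_cast stub_cellCount k
    have hB : ((Nat.choose (14 * k) (4 * k) * Nat.choose (4 * k) (2 * k) : ℕ) : ℝ) ≤
        (2 : ℝ) ^ (η * k) * L := hrate
    have hB' : (Nat.choose (14 * k) (4 * k) : ℝ) * (Nat.choose (4 * k) (2 * k) : ℝ) ≤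
        (2 : ℝ) ^ (η * k) * L := by push_cast at hB; exact hB
    have hC : ((14 * k + 1 : ℝ)) ^ 2 ≤ ((3125 / 2 : ℝ) ^ η) ^ k := hk₁ k hkk₁
    have h5pos : (0 : ℝ) < (5 : ℝ) ^ (5 * k) := by positivity
    have hsplit : ((5 : ℝ) ^ (5 * k)) ^ (2 + η) = (5 : ℝ) ^ (10 * k) * ((5 : ℝ) ^ (5 * k)) ^ η := by
      rw [Real.rpow_add h5pos, Real.rpow_two, ← pow_mul, show 5 * k * 2 = 10 * k by ring]
    have hkey : ((3125 / 2 : ℝ) ^ η) ^ k * (2 : ℝ) ^ (η * k) = ((5 : ℝ) ^ (5 * k)) ^ η := by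
      rw [← Real.rpow_mul_natCast (by norm_num : (0 : ℝ) ≤ 3125 / 2),
        ← Real.mul_rpow (by norm_num : (0 : ℝ) ≤ 3125 / 2) (by norm_num : (0 : ℝ) ≤ 2), pow_mul,
        ← Real.rpow_natCast_mul (by norm_num : (0 : ℝ) ≤ 5 ^ 5) k η, mul_comm (k : ℝ) η]
      norm_num
    calc (7 : ℝ) ^ (14 * k)
        ≤ (14 * k + 1) ^ 2 * (Nat.choose (14 * k) (4 * k) * Nat.choose (4 * k) (2 * k)) *
            5 ^ (10 * k) := hA
      _ ≤ ((3125 / 2 : ℝ) ^ η) ^ k * ((2 : ℝ) ^ (η * k) * L) * 5 ^ (10 * k) := by gcongr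
      _ = L * ((5 : ℝ) ^ (10 * k) * (((3125 / 2 : ℝ) ^ η) ^ k * (2 : ℝ) ^ (η * k))) := by ring
      _ = L * ((5 : ℝ) ^ (5 * k)) ^ (2 + η) := by rw [hkey, hsplit]

end Summit.MatrixMultiplication.MatrixMultiplication.Cruxes.BoundedExponentThird.GibbsPartitionCharts
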